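import Mathlib
import HarnessLib


/-!
# `TwistUnpackaging` (stmt-Langlands-10903) — Negative knowledge I: the per-place separation step

Support / negative lemmas for the crux `Summit.Langlands.Langlands.Theses.QuadraticWindow.TwistUnpackaging`
(route QuadraticWindow, rank 4), from the standing disprover's `Disproof.lean` (cdisprove cycle 2):
the cofinite step of the twist extraction at a split place, settled in every rank.
`Separates n t ↔ (orderOf t = 0 ∨ n < orderOf t)`: one controlled admissible twist whose ratio
`t = ψ̃(Frob_τw)/ψ̃(Frob_w)` has order `> n` (or infinite order) separates the halves of
`{roots P_w} ∪ {roots P_τw}`; order `≤ n` NEVER does (orbit-swap witnesses, all `n`), `t = 1` is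
uninformative, two generic twists make `ψ = 1` dispensable, inert places need nothing.
Pure multiset combinatorics over `ℂ` (Mathlib only). [folklore]
-/

namespace Summit.Langlands.Langlands.Theorems.TwistUnpackaging.Negative

open Multiset

/-! ## The per-place separation step, settled in every rank

At a good place `v` of `F₀` split in `F` as `{w, τw}`, write `X, X'` for the eigenvalue multisets of
the extracted `ρ` at `Frob_w, Frob_τw` and `S, S'` for the root multisets of the Satake polynomials
`P_w, P_τw`. The controlled member `ψ = 1` gives `X + X' = S + S'`; a controlled admissible `ψ`
with ratio `t = ψ̃(Frob_τw)/ψ̃(Frob_w)` gives `X + t•X' = S + t•S'` (the place `τw` gives the same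
identity). The cofinite step at `w` is: conclude `X = S`. -/

/-- `Separates n t`: in rank `n`, the `ψ = 1` identity and ONE twisted identity of ratio `t` force
the halves apart. [folklore] -/
def Separates (n : ℕ) (t : ℂ) : Prop :=
  ∀ X X' S S' : Multiset ℂ, card X = n → card X' = n → card S = n → card S' = n →
    X + X' = S + S' → X + X'.map (t * ·) = S + S'.map (t * ·) → X = S

/-- The `t`-orbit `{1, t, …, t^{d-1}}`, `d = orderOf t`, as a finset (empty if `orderOf t = 0`).
[folklore] -/
noncomputable def orbit (t : ℂ) : Finset ℂ := (Finset.range (orderOf t)).image (fun j => t ^ j)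

/-- Membership in the orbit. [folklore] -/
lemma mem_orbit {t z : ℂ} : z ∈ orbit t ↔ ∃ j < orderOf t, t ^ j = z := by
  simp [orbit]

/-- The orbit has `orderOf t` elements (`pow_injOn_Iio_orderOf`). [folklore] -/
lemma card_orbit (t : ℂ) : (orbit t).card = orderOf t := by
  rw [orbit, Finset.card_image_of_injOn, Finset.card_range]
  intro i hi j hj h
  exact pow_injOn_Iio_orderOf (by simpa using hi) (by simpa using hj) h

/-- `1 = t^0` lies in the orbit when `t` has finite order. [folklore] -/
lemma one_mem_orbit {t : ℂ} (ht : 0 < orderOf t) : (1 : ℂ) ∈ orbit t :=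
  mem_orbit.2 ⟨0, ht, pow_zero t⟩

/-- The orbit is stable under multiplication by `t` (`t^d = 1`). [folklore] -/
lemma orbit_image_mul {t : ℂ} (ht : 0 < orderOf t) :
    (orbit t).image (t * ·) = orbit t := by
  ext z
  simp only [Finset.mem_image, mem_orbit]
  constructor
  · rintro ⟨y, ⟨j, hj, rfl⟩, rfl⟩
    refine ⟨(j + 1) % orderOf t, Nat.mod_lt _ ht, ?_⟩
    rw [pow_mod_orderOf, pow_succ, mul_comm]
  · rintro ⟨j, hj, rfl⟩
    refine ⟨t ^ ((j + orderOf t - 1) % orderOf t), ⟨_, Nat.mod_lt _ ht, rfl⟩, ?_⟩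
    rw [pow_mod_orderOf, ← pow_succ']
    have : j + orderOf t - 1 + 1 = j + orderOf t := by omega
    rw [this, pow_add, pow_orderOf_eq_one, mul_one]

/-- Multiset form of the orbit stability. [folklore] -/
lemma orbit_val_map_mul {t : ℂ} (ht : 0 < orderOf t) :
    (orbit t).val.map (t * ·) = (orbit t).val := by
  have hinj : Function.Injective (fun z : ℂ => t * z) := by
    intro a b h
    have ht0 : t ≠ 0 := by
      rintro rfl
      simp at ht
    exact mul_left_cancel₀ ht0 h
  have := congrArg Finset.val (orbit_image_mul ht)
  rwa [Finset.image_val_of_injOn (hinj.injOn)] at this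

/-- An element of finite positive order in `ℂ` has norm `1`. [folklore] -/
lemma norm_eq_one_of_orderOf_pos {t : ℂ} (ht : 0 < orderOf t) : ‖t‖ = 1 := by
  have h := pow_orderOf_eq_one t
  have : ‖t‖ ^ orderOf t = 1 := by rw [← norm_pow, h, norm_one]
  exact (pow_eq_one_iff_of_nonneg (norm_nonneg t) ht.ne').1 this

/-- Orbit points have norm `1`. [folklore] -/
lemma norm_of_mem_orbit {t z : ℂ} (ht : 0 < orderOf t) (hz : z ∈ orbit t) : ‖z‖ = 1 := by
  obtain ⟨j, -, rfl⟩ := mem_orbit.1 hz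
  rw [norm_pow, norm_eq_one_of_orderOf_pos ht, one_pow]

/-- **NECESSITY (all ranks; refuted strengthening "ratio of order `≤ n` separates").** If the
ratio `t` has finite order `d` with `0 < d ≤ n`, then `t` does NOT separate in rank `n`: the two
halves can be swapped along a `t`-orbit. Witness `X = O + T`, `S = 2O + T`, `X' = 2O + T'`,
`S' = O + T'` with `O` the `t`-orbit (card `d`) and `T = T'` the padding `replicate (n-d) 3`;
`1 ∈ X ∖ S` by a norm count. Generalises the gen-1 `decide` witnesses (`n = 2`, `t = -1`;
`n = 3`, `orderOf t = 3`) to every `n` and every order `d ≤ n`. [folklore] -/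
theorem not_separates_of_orderOf_le {n : ℕ} {t : ℂ} (ht : 0 < orderOf t) (hle : orderOf t ≤ n) :
    ¬ Separates n t := by
  intro hsep
  set O : Multiset ℂ := (orbit t).val with hO
  set T : Multiset ℂ := Multiset.replicate (n - orderOf t) (3 : ℂ) with hT
  have hOcard : card O = orderOf t := by simp [hO, card_orbit]
  have hTcard : card T = n - orderOf t := by simp [hT]
  have hOt : O.map (t * ·) = O := orbit_val_map_mul ht
  have hO2t : (O.map ((2 : ℂ) * ·)).map (t * ·) = O.map ((2 : ℂ) * ·) := by
    rw [Multiset.map_map]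
    have : ((fun x => t * x) ∘ fun x => (2 : ℂ) * x) = (fun x => (2 : ℂ) * x) ∘ fun x => t * x := by
      ext x; simp [mul_left_comm]
    rw [this, ← Multiset.map_map, hOt]
  have hcard : ∀ M : Multiset ℂ, card M = orderOf t → card (M + T) = n := by
    intro M hM; rw [card_add, hM, hTcard]; omega
  have key := hsep (O + T) (O.map ((2 : ℂ) * ·) + T) (O.map ((2 : ℂ) * ·) + T) (O + T)
    (hcard O hOcard) (hcard _ (by simp [hOcard])) (hcard _ (by simp [hOcard])) (hcard O hOcard)
    (by abel) (by rw [Multiset.map_add, Multiset.map_add, hO2t, hOt]; abel)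
  have h1 : (1 : ℂ) ∈ O + T := Multiset.mem_add.2 (Or.inl (by simpa [hO] using one_mem_orbit ht))
  rw [key] at h1
  rcases Multiset.mem_add.1 h1 with h | h
  · obtain ⟨z, hz, hz1⟩ := Multiset.mem_map.1 h
    have hz' : ‖z‖ = 1 := norm_of_mem_orbit ht (by simpa [hO] using hz)
    have : ‖(2 : ℂ) * z‖ = 1 := by rw [hz1, norm_one]
    rw [norm_mul, hz'] at this
    norm_num at this
  · rw [hT, Multiset.mem_replicate] at h
    norm_num at h

/-- **TIGHTNESS at `t = 1`.** A twist with `ψ̃(Frob_w) = ψ̃(Frob_τw)` carries no information at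
`w` in any rank `n ≥ 1` (so non-τ-invariant-at-`w` admissible twists are indispensable).
[folklore] -/
theorem not_separates_one {n : ℕ} (hn : 1 ≤ n) : ¬ Separates n 1 :=
  not_separates_of_orderOf_le (by simp) (by simpa using hn)

/-- **SUFFICIENCY (all ranks).** If the ratio `t` has infinite order (`orderOf t = 0`; this
includes the junk value `t = 0`) or finite order `> n`, then `t` separates: the signed count
difference `D = X - S` is `t`-invariant with total mass `0`, so a non-zero `D` would contain a
whole `t`-orbit of a NON-ZERO point inside `X.toFinset` (or `S.toFinset`), of size `> n` resp.
infinite. (Re-derivation, for self-containedness, of the gen-1 lemmas `twistSeparation_of_orderOf`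
/ `twistSeparation_sharp`.) [folklore] -/
theorem separates_of {n : ℕ} {t : ℂ} (h : orderOf t = 0 ∨ n < orderOf t) : Separates n t := by
  intro X X' S S' hX hX' hS hS' h1 h2
  by_cases ht0 : t = 0
  · subst ht0
    have hc : ∀ M : Multiset ℂ, card M = n → M.map ((0:ℂ) * ·) = replicate n 0 := by
      intro M hM; simp [Multiset.map_const', hM]
    rw [hc X' hX', hc S' hS'] at h2
    exact add_right_cancel h2
  -- the signed count difference `D = X - S` is `t`-invariant
  set D : ℂ → ℤ := fun z => (count z X : ℤ) - count z S with hD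
  have hD1 : ∀ z, D z = (count z S' : ℤ) - count z X' := by
    intro z
    have := congrArg (count z) h1
    simp only [count_add] at this
    simp only [hD]; omega
  have hcnt : ∀ (M : Multiset ℂ) (z : ℂ), count (t * z) (M.map (t * ·)) = count z M :=
    fun M z => count_map_eq_count' _ _ (mul_right_injective₀ ht0) _
  have hD2 : ∀ z, D (t * z) = D z := by
    intro z
    have := congrArg (count (t * z)) h2
    simp only [count_add, hcnt] at this
    rw [hD1 z]; simp only [hD]; omega
  have hDpow : ∀ (k : ℕ) (z : ℂ), D (t ^ k * z) = D z := by
    intro k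
    induction k with
    | zero => intro z; simp
    | succ k ih => intro z; rw [pow_succ', mul_assoc, hD2, ih]
  -- total mass of `D` is zero
  set F : Finset ℂ := (X + S).toFinset with hF
  have hmass : ∑ z ∈ F, D z = 0 := by
    have hXF : ∀ a ∈ X, a ∈ F := fun a ha => by simp [hF, ha]
    have hSF : ∀ a ∈ S, a ∈ F := fun a ha => by simp [hF, ha]
    have h₁ := Multiset.sum_count_eq_card hXF
    have h₂ := Multiset.sum_count_eq_card hSF
    simp only [hD, Finset.sum_sub_distrib]
    have hnat : ∑ a ∈ F, count a X = ∑ a ∈ F, count a S := by rw [h₁, h₂, hX, hS]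
    have hint : (∑ x ∈ F, (count x X : ℤ)) = ∑ x ∈ F, (count x S : ℤ) := by exact_mod_cast hnat
    rw [hint, sub_self]
  by_contra hne
  have hz : ∃ z, D z ≠ 0 := by
    by_contra hall
    push Not at hall
    exact hne (Multiset.ext.mpr fun a => by have := hall a; simp only [hD] at this; omega)
  -- some NON-ZERO `z₀` has `D z₀ ≠ 0`
  have hz0 : ∃ z₀, z₀ ≠ 0 ∧ D z₀ ≠ 0 := by
    obtain ⟨z, hz⟩ := hz
    by_cases hz' : z = 0
    · subst hz'
      by_contra hall
      push Not at hall
      have h0F : (0 : ℂ) ∈ F := by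
        simp only [hF, Multiset.mem_toFinset, Multiset.mem_add]
        by_contra h0
        push Not at h0
        have h0X : count (0:ℂ) X = 0 := count_eq_zero.2 h0.1
        have h0S : count (0:ℂ) S = 0 := count_eq_zero.2 h0.2
        apply hz; simp [hD, h0X, h0S]
      have : ∑ z ∈ F, D z = D 0 :=
        Finset.sum_eq_single_of_mem (0:ℂ) h0F fun b _ hb => hall b hb
      exact hz (this ▸ hmass)
    · exact ⟨z, hz', hz⟩
  obtain ⟨z₀, hz₀, hDz₀⟩ := hz0
  have hsupp : ∀ z, D z ≠ 0 → z ∈ X.toFinset ∪ S.toFinset := by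
    intro z hDz
    simp only [Finset.mem_union, Multiset.mem_toFinset]
    by_contra hno
    push Not at hno
    apply hDz
    simp [hD, count_eq_zero.2 hno.1, count_eq_zero.2 hno.2]
  rcases h with h0 | hlt
  · -- infinite order: `k ↦ t^k z₀` is injective with values in a finite set
    have hinj : Function.Injective (fun k : ℕ => t ^ k * z₀) := by
      intro k l hkl
      have hkl' : t ^ k = t ^ l := mul_right_cancel₀ hz₀ hkl
      by_contra hne'
      have key : ∀ k l : ℕ, k < l → t ^ k = t ^ l → False := by
        intro k l hlt' he
        have : t ^ k * t ^ (l - k) = t ^ k * 1 := by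
          rw [mul_one, ← pow_add, Nat.add_sub_cancel' hlt'.le, he]
        have h1' : t ^ (l - k) = 1 := mul_left_cancel₀ (pow_ne_zero _ ht0) this
        have hfin : IsOfFinOrder t := isOfFinOrder_iff_pow_eq_one.2 ⟨l - k, by omega, h1'⟩
        exact absurd h0 hfin.orderOf_pos.ne'
      rcases Nat.lt_or_gt_of_ne hne' with hlt' | hlt'
      · exact key k l hlt' hkl'
      · exact key l k hlt' hkl'.symm
    have hmem : ∀ k : ℕ, t ^ k * z₀ ∈ ((X.toFinset ∪ S.toFinset : Finset ℂ) : Set ℂ) := by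
      intro k
      exact hsupp _ (by rw [hDpow]; exact hDz₀)
    exact (Set.infinite_of_injective_forall_mem hinj hmem) (Finset.finite_toSet _)
  · -- finite order `d > n`: the orbit of `z₀` has `d` points of positive count in `X` or in `S`
    set Orb : Finset ℂ := (orbit t).image (· * z₀) with hOrb
    have hOrbcard : Orb.card = orderOf t := by
      rw [hOrb, Finset.card_image_of_injective _ (mul_left_injective₀ hz₀), card_orbit]
    have hOrbD : ∀ z ∈ Orb, D z = D z₀ := by
      intro z hz
      obtain ⟨y, hy, rfl⟩ := Finset.mem_image.1 hz
      obtain ⟨j, -, rfl⟩ := mem_orbit.1 hy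
      exact hDpow j z₀
    rcases lt_or_gt_of_ne hDz₀ with hneg | hpos
    · have hsub : Orb ⊆ S.toFinset := by
        intro z hz
        have := hOrbD z hz
        rw [Multiset.mem_toFinset, ← count_pos]
        simp only [hD] at this hneg
        omega
      have := Finset.card_le_card hsub
      rw [hOrbcard] at this
      have := Multiset.toFinset_card_le S
      omega
    · have hsub : Orb ⊆ X.toFinset := by
        intro z hz
        have := hOrbD z hz
        rw [Multiset.mem_toFinset, ← count_pos]
        simp only [hD] at this hpos
        omega
      have := Finset.card_le_card hsub
      rw [hOrbcard] at this
      have := Multiset.toFinset_card_le X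
      omega

/-- **THE PER-PLACE STEP, SETTLED.** One controlled admissible twist of ratio `t` at `w`
(together with `ψ = 1`) separates in rank `n` iff `t` has infinite order or finite order `> n`.
For Artin avatars `t` is a root of unity, so: order `> n`, and order `≤ n` never suffices.
[folklore] -/
theorem separates_iff {n : ℕ} {t : ℂ} : Separates n t ↔ (orderOf t = 0 ∨ n < orderOf t) := by
  refine ⟨fun h => ?_, separates_of⟩
  by_contra hc
  push Not at hc
  exact not_separates_of_orderOf_le (Nat.pos_of_ne_zero hc.1) hc.2 h

/-- **`hnti` is not load-bearing for the extraction** (refuted presumption "the `ψ = 1` member is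
needed"): two controlled twists with ratios `t₁ ≠ 0` and `t₂` at `w` such that `t₂ / t₁` has
infinite order or order `> n` already force `X = S`, WITHOUT the `ψ = 1` identity. (In the crux,
`hnti` serves upstream — cuspidality of `AI(π ⊗ ψ)` in `HostInducedRep` — and makes `ψ = 1`
admissible; admissible twists exist without it, by Chebotarev applied to `ψ^τ/ψ ≠ 1`.)
[folklore] -/
theorem separates_two_twists {n : ℕ} {t₁ t₂ : ℂ} (ht₁ : t₁ ≠ 0)
    (h : orderOf (t₂ / t₁) = 0 ∨ n < orderOf (t₂ / t₁))
    (X X' S S' : Multiset ℂ) (hX : card X = n) (hX' : card X' = n) (hS : card S = n)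
    (hS' : card S' = n)
    (h₁ : X + X'.map (t₁ * ·) = S + S'.map (t₁ * ·))
    (h₂ : X + X'.map (t₂ * ·) = S + S'.map (t₂ * ·)) : X = S := by
  refine separates_of h X (X'.map (t₁ * ·)) S (S'.map (t₁ * ·)) hX (by simp [hX']) hS
    (by simp [hS']) h₁ ?_
  have e : ∀ M : Multiset ℂ, (M.map (t₁ * ·)).map (t₂ / t₁ * ·) = M.map (t₂ * ·) := by
    intro M
    rw [Multiset.map_map]
    congr 1
    ext x
    simp only [Function.comp_apply]
    field_simp
  rw [e, e]
  exact h₂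

/-- **Inert places need no twist.** At a place `v` of `F₀` inert in `F` (`w = τw`, `f = 2`) the
controlled `ψ = 1` member gives `charpoly R_1(Frob_v) = P_w(X²)`, hence
`charpoly A(Frob_w) = charpoly R_1(Frob_v)² ↦ P_w²` while `A ≅ ρ ⊕ ρ^τ` and `ρ^τ(Frob_w)` is a
Frobenius at the conjugate prime above the same `w`: `X + X = S + S`, which pins `X = S`.
[folklore] -/
theorem inert_halving (X S : Multiset ℂ) (h : X + X = S + S) : X = S := by
  ext a
  have := congrArg (Multiset.count a) h
  simp only [Multiset.count_add] at this
  omega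


end Summit.Langlands.Langlands.Theorems.TwistUnpackaging.Negative
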